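import Literature.AnabelianGeometry.AbsoluteAnabelian.AbsTopII.TwoTripodNodalFixedSubgroup
import Literature.AnabelianGeometry.AbsoluteAnabelian.AbsTopII.DehnTwistLoopProp13vPrime
import HarnessLib

/-!
# [AbsTopII] Prop 1.3 (v) at the two-vertex nodal datum, II: `D_v = C(I_v) = N(I_v)` — typed `Prop13v` and `Prop_1_3_v'`, no hypothesis

S. Mochizuki, *Topics in Absolute Anabelian Geometry II* [AbsTopII] (bib `MochizukiAbsTopII2013`; locators =
PDF pages of the kurims manuscript `paper:url-585b8d0ad0d9`), §1 Prop 1.3 (v) p. 12: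

> "(v) `D_v = C_{Π_H}(I_v) = N_{Π_H}(I_v)` is commensurably terminal in `Π_H`; `D_v ∩ Π_I = C_{Π_I}(I_v) = N_{Π_I}(I_v) =
> Z_{Π_I}(I_v)` is commensurably terminal in `Π_I`, and we have `D_v ∩ Π_𝔾 = Π_v`; `Π_v` is commensurably terminal
> in `Π_𝔾`."

PROOF-ONLY companion of `AbsTopII/TwoTripodNodalDatum.lean` (abc-iut-f-066 gen 6, row «P13v-TWO-VERTEX»), over part I
`TwoTripodNodalFixedSubgroup.lean` (KEY₂: the fixed subgroup of a power of the Dehn twist in `Π_𝔾` is the verticial free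
factor).  At `M.dpsc` (two tripods `v_A`, `v_B`, ONE non-loop node, `Π_H = Π_I = P`, `I_{v_A} = T`, `I_{v_B} = U`,
`D_{v_A} = Π_{v_A}·T`, `D_{v_B} = Π_{v_B}·U` — abc-iut-f-066 gen 5), EVERY `Σ`:

* `commensurator_eq_sup_of_key` — the GENERIC step: for a closed section `S = ⟨s₀⟩^` (`S ∩ Π_𝔾 = 1`, `S·Π_𝔾 = P`)
  centralising `K`, abelian, with the key property «`γ ∈ Π_𝔾` commuting with some `s₀ⁿ` (`n ≥ 1`) lies in `K`», one has
  `C_P(S) = N_P(S) = Z_P(S) = K · S` (a commensurating `γ ∈ Π_𝔾` has `s₀ⁿ ∈ γSγ⁻¹`; the retraction `P → T`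
  (p466644), injective on `S`, turns `s₀ⁿ = γ s γ⁻¹` into `s = s₀ⁿ`);
* `prop13v_dpsc` — **[AbsTopII] Prop 1.3 (v) AS TYPED (`DPSCData.Prop13v`, F-0278) HOLDS at the two-vertex nodal
  datum, no hypothesis, at BOTH vertices**: `D_v = C(I_v) = N(I_v)` commensurably terminal, `D_v ∩ Π_𝔾 = Π_v`
  commensurably terminal in `Π_𝔾`;
* `prop_1_3_v'_dpsc` — **the middle clause AS TYPED (`DPSCIndexData.Prop_1_3_v'`, F-0300) HOLDS**, no hypothesis
  (`Π_I = Π_H`; abc-iut-f-069's transport lemmas along the bijective `(⊤ : Subgroup P).subtype`, p467551, by name);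
* `exists_twoVertex_nodal_model_v` — the summary: ONE DPSC datum with two vertices carrying the typed (i), (ii′),
  (iii), (iii′), (iv′), (iv)-«Moreover», (v), (v′), (vi), (vii), (ix) SIMULTANEOUSLY, every `Σ`.
HONEST FRAMING: classical profinite group theory at a constructed model (constructed ≠ geometric); consistency
evidence for the typed rows F-0278 / F-0300, not a discharge at geometric data; nothing here bears on [IUTchIII]
Cor 3.12; no side taken; typed ≠ proved for print's statement about all stable log curves.
-/

noncomputable section

open scoped Pointwise

namespace Literature.AnabelianGeometry.AbsoluteAnabelian.AbsTopII.TwoTripodNodal.Model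

open Literature.AnabelianGeometry.SemiGraphs
open Literature.AnabelianGeometry.SemiGraphs.SemiGraphOfAnabelioids (IsProSigmaCompletion)
open Literature.AnabelianGeometry.SemiGraphs.SemiGraphOfAnabelioids.IsProSigmaCompletion
open Literature.AnabelianGeometry.Anabelioids (IsSigmaInteger normalizer_le_commensurator)
open Literature.GroupTheory.CombinatorialGroupTheory
open Literature.GroupTheory.CombinatorialGroupTheory.PuncturedSurfaceGroup
open _root_.Topology

variable {Sigma : Set ℕ} (M : Model Sigma)

/-! ### The generic step: a section with the key property -/

/-- **`C_P(S) ⊆ K · S`** for a section `S ∋ s₀` (`S ∩ Π_𝔾 = 1`, `S · Π_𝔾 = P`) with the key property «an element of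
`Π_𝔾` commuting with some `s₀ⁿ`, `n ≥ 1`, lies in `K`»: for `x = s·γ ∈ C_P(S)` (`s ∈ S`, `γ ∈ Π_𝔾`), `γ` commensurates
`S`, so `s₀ⁿ = γ s' γ⁻¹` for some `n ≥ 1`, `s' ∈ S`; the retraction `F : P → T` (identity on `T`, trivial on `Π_𝔾`,
injective on `S`) gives `s' = s₀ⁿ`, i.e. `γ` commutes with `s₀ⁿ`. [cite: MochizukiAbsTopII2013, Prop 1.3 (v) p.12] -/
theorem commensurator_le_sup_of_key (K S : Subgroup M.P) {s₀ : M.P} (hs₀ : s₀ ∈ S) (hSbot : S ⊓ M.PiG = ⊥)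
    (hSG : S ⊔ M.PiG = ⊤)
    (hkey : ∀ γ ∈ M.PiG, ∀ n : ℕ, 0 < n → γ * s₀ ^ n = s₀ ^ n * γ → γ ∈ K) :
    Subgroup.Commensurable.commensurator S ≤ K ⊔ S := by
  haveI : M.PiG.Normal := M.normal_PiG
  obtain ⟨F, -, -, hFT, hFA⟩ := SemidirectCofinal.exists_retraction M.φ M.isProSigmaCompletion
  have hF1 : ∀ z : M.P, F z = 1 ↔ z ∈ M.PiG := fun z =>
    SemidirectCofinal.retraction_eq_one_iff M.φ M.isProSigmaCompletion hFT hFA z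
  -- `F` is injective on `S`
  have hFinj : ∀ a ∈ S, ∀ c ∈ S, F a = F c → a = c := by
    intro a ha c hc hac
    have h1 : F (a⁻¹ * c) = 1 := by rw [map_mul, map_inv, hac, inv_mul_cancel]
    have h2 : a⁻¹ * c ∈ S ⊓ M.PiG := ⟨S.mul_mem (S.inv_mem ha) hc, (hF1 _).mp h1⟩
    rw [hSbot, Subgroup.mem_bot] at h2
    exact inv_mul_eq_one.mp h2
  intro x hx
  -- `x = s · γ`
  have hx' : x ∈ ((S ⊔ M.PiG : Subgroup M.P) : Set M.P) := by rw [hSG]; exact Subgroup.mem_top x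
  rw [Subgroup.mul_normal] at hx'
  obtain ⟨s, hs, γ, hγ, rfl⟩ := Set.mem_mul.mp hx'
  have hsC : s ∈ Subgroup.Commensurable.commensurator S :=
    normalizer_le_commensurator _ (Subgroup.le_normalizer hs)
  have hγC : γ ∈ Subgroup.Commensurable.commensurator S := by
    have := Subgroup.mul_mem _ (Subgroup.inv_mem _ hsC) hx
    rwa [inv_mul_cancel_left] at this
  -- `s₀ⁿ ∈ γ S γ⁻¹` for some `n ≥ 1`
  rw [Subgroup.Commensurable.commensurator_mem_iff] at hγC
  obtain ⟨n, hn, -, hmem⟩ := Subgroup.exists_pow_mem_of_index_ne_zero hγC.1 (⟨s₀, hs₀⟩ : ↥S)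
  rw [Subgroup.mem_subgroupOf, SubmonoidClass.coe_pow] at hmem
  change s₀ ^ n ∈ ConjAct.toConjAct γ • S at hmem
  obtain ⟨s', hs', hs'eq⟩ := (Subgroup.mem_smul_pointwise_iff_exists _ _ _).mp hmem
  rw [ConjAct.smul_def, ConjAct.ofConjAct_toConjAct] at hs'eq
  -- the retraction: `s' = s₀ⁿ`
  have hFeq : F s' = F (s₀ ^ n) := by
    rw [← hs'eq, map_mul, map_mul, map_inv, (hF1 γ).mpr hγ, one_mul, inv_one, mul_one]
  have hs'n : s' = s₀ ^ n := hFinj s' hs' _ (S.pow_mem hs₀ n) hFeq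
  rw [hs'n] at hs'eq
  -- `γ` commutes with `s₀ⁿ`, hence lies in `K`
  have hcomm : γ * s₀ ^ n = s₀ ^ n * γ := by
    calc γ * s₀ ^ n = γ * s₀ ^ n * γ⁻¹ * γ := by group
      _ = s₀ ^ n * γ := by rw [hs'eq]
  exact Subgroup.mul_mem _ (Subgroup.mem_sup_right hs) (Subgroup.mem_sup_left (hkey γ hγ n hn hcomm))

/-- **`C_P(S) = N_P(S) = Z_P(S) = K · S`** for an abelian section `S ∋ s₀` centralising `K` with the key property.
[cite: MochizukiAbsTopII2013, Prop 1.3 (v) p.12] -/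
theorem commensurator_eq_sup_of_key (K S : Subgroup M.P) {s₀ : M.P} (hs₀ : s₀ ∈ S) (hSbot : S ⊓ M.PiG = ⊥)
    (hSG : S ⊔ M.PiG = ⊤) (hSK : S ≤ Subgroup.centralizer (K : Set M.P)) (hSS : ∀ a ∈ S, ∀ c ∈ S, a * c = c * a)
    (hkey : ∀ γ ∈ M.PiG, ∀ n : ℕ, 0 < n → γ * s₀ ^ n = s₀ ^ n * γ → γ ∈ K) :
    Subgroup.Commensurable.commensurator S = K ⊔ S ∧ Subgroup.normalizer (S : Set M.P) = K ⊔ S ∧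
      Subgroup.centralizer (S : Set M.P) = K ⊔ S := by
  have hKc : K ≤ Subgroup.centralizer (S : Set M.P) := Subgroup.le_centralizer_iff.mp hSK
  have hSc : S ≤ Subgroup.centralizer (S : Set M.P) := fun a ha =>
    Subgroup.mem_centralizer_iff.mpr fun c hc => (hSS a ha c hc).symm
  have h1 : K ⊔ S ≤ Subgroup.centralizer (S : Set M.P) := sup_le hKc hSc
  have h2 : Subgroup.centralizer (S : Set M.P) ≤ Subgroup.normalizer (S : Set M.P) := Subgroup.centralizer_le_normalizer _
  have h3 : Subgroup.normalizer (S : Set M.P) ≤ Subgroup.Commensurable.commensurator S := normalizer_le_commensurator _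
  have h4 := M.commensurator_le_sup_of_key K S hs₀ hSbot hSG hkey
  exact ⟨le_antisymm h4 (le_trans h1 (le_trans h2 h3)), le_antisymm (le_trans h3 h4) (le_trans h1 h2),
    le_antisymm (le_trans h2 (le_trans h3 h4)) h1⟩

/-! ### The two vertices -/

/-- `T ∩ Π_𝔾 = {1}`. [cite: MochizukiAbsTopII2013, Prop 1.3 (iii) p.11] -/
theorem T_inf_PiG : M.T ⊓ M.PiG = ⊥ := by
  rw [Model.T, Model.PiG]; exact SemidirectCofinal.closure_inr_inf_closure_inl_eq_bot M.φ M.isProSigmaCompletion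

/-- `t₀ = ι(inr 1) ∈ T`. [cite: MochizukiAbsTopII2013, Prop 1.3 (iii) p.11] -/
theorem t0_mem_T : M.ι (SemidirectProduct.inr (Multiplicative.ofAdd (1 : ℤ))) ∈ M.T :=
  Subgroup.le_topologicalClosure _ ⟨_, ⟨Multiplicative.ofAdd (1 : ℤ), rfl⟩, rfl⟩

/-- `u₀ = ι(inl (c₁c₂)⁻¹ · inr 1) ∈ U`. [cite: MochizukiAbsTopII2013, Prop 1.3 (iii) p.11] -/
theorem u0_mem_U : M.ι (SemidirectProduct.inl (c 1 * c 2 : PuncturedSurfaceGroup 0 4)⁻¹ *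
    SemidirectProduct.inr (Multiplicative.ofAdd (1 : ℤ))) ∈ M.U :=
  Subgroup.le_topologicalClosure _ (Subgroup.mem_zpowers _)

/-- **At `v_A`: `C_P(T) = N_P(T) = Z_P(T) = Π_{v_A} · T`**, no hypothesis (KEY₂ for `T`).
[cite: MochizukiAbsTopII2013, Prop 1.3 (v) p.12] -/
theorem commensurator_T_eq (hne : Sigma.Nonempty) (hprime : ∀ p ∈ Sigma, p.Prime) :
    Subgroup.Commensurable.commensurator M.T = (M.vertGpA).map M.PiG.subtype ⊔ M.T ∧
      Subgroup.normalizer (M.T : Set M.P) = (M.vertGpA).map M.PiG.subtype ⊔ M.T ∧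
      Subgroup.centralizer (M.T : Set M.P) = (M.vertGpA).map M.PiG.subtype ⊔ M.T :=
  M.commensurator_eq_sup_of_key _ M.T M.t0_mem_T M.T_inf_PiG (by rw [sup_comm]; exact M.PiG_sup_T)
    M.T_le_centralizer_vertGpA M.isFreeProSigmaCyclic_T.subgroup_comm
    (fun _ hγ _ hn hc => M.mem_vertGpA_of_commute_pow_T hne hprime hγ hn hc)

/-- **At `v_B`: `C_P(U) = N_P(U) = Z_P(U) = Π_{v_B} · U`**, no hypothesis (KEY₂ for `U`).
[cite: MochizukiAbsTopII2013, Prop 1.3 (v) p.12] -/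
theorem commensurator_U_eq (hne : Sigma.Nonempty) (hprime : ∀ p ∈ Sigma, p.Prime) :
    Subgroup.Commensurable.commensurator M.U = (M.vertGpB).map M.PiG.subtype ⊔ M.U ∧
      Subgroup.normalizer (M.U : Set M.P) = (M.vertGpB).map M.PiG.subtype ⊔ M.U ∧
      Subgroup.centralizer (M.U : Set M.P) = (M.vertGpB).map M.PiG.subtype ⊔ M.U :=
  M.commensurator_eq_sup_of_key _ M.U M.u0_mem_U (M.U_inf_PiG hne hprime) M.U_sup_PiG
    M.U_le_centralizer_vertGpB (M.isFreeProSigmaCyclic_U hne hprime).subgroup_comm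
    (fun _ hγ _ hn hc => M.mem_vertGpB_of_commute_pow_U hne hprime hγ hn hc)

/-- `D_v = Π_v · I_v` and `C_P(I_v) = N_P(I_v) = Z_P(I_v) = D_v` at every vertex of the datum.
[cite: MochizukiAbsTopII2013, Prop 1.3 (v) p.12] -/
theorem Dv_eq_commensurator_Iv (hne : Sigma.Nonempty) (hprime : ∀ p ∈ Sigma, p.Prime) (v : (M.dpsc hne hprime).Vert) :
    (M.dpsc hne hprime).Dv v = Subgroup.Commensurable.commensurator ((M.dpsc hne hprime).Iv v) ∧
      (M.dpsc hne hprime).Dv v = Subgroup.normalizer (((M.dpsc hne hprime).Iv v : Subgroup (M.dpsc hne hprime).PiH) :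
        Set (M.dpsc hne hprime).PiH) ∧
      (M.dpsc hne hprime).Dv v = Subgroup.centralizer (((M.dpsc hne hprime).Iv v : Subgroup (M.dpsc hne hprime).PiH) :
        Set (M.dpsc hne hprime).PiH) := by
  rcases M.vert_cases hne hprime v with rfl | rfl
  · obtain ⟨h1, h2, h3⟩ := M.commensurator_T_eq hne hprime
    rw [Dv_zero_eq, Iv_eq_T]
    exact ⟨h1.symm, h2.symm, h3.symm⟩
  · obtain ⟨h1, h2, h3⟩ := M.commensurator_U_eq hne hprime
    rw [Dv_one_eq, Iv_eq_U]
    exact ⟨h1.symm, h2.symm, h3.symm⟩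

/-- **`D_v` is commensurably terminal in `P`** at both vertices (free-factor commensurable terminality of `Π_v` in
`Π_𝔾` + the centralising section; abc-iut-f-066 gen 5 `isCommensurablyTerminal_sup_of_section`).
[cite: MochizukiAbsTopII2013, Prop 1.3 (v) p.12] -/
theorem isCommensurablyTerminal_Dv (hne : Sigma.Nonempty) (hprime : ∀ p ∈ Sigma, p.Prime) (v : (M.dpsc hne hprime).Vert) :
    IsCommensurablyTerminal ((M.dpsc hne hprime).Dv v) := by
  have hK : ∀ w : (M.dpsc hne hprime).Vert,
      Subgroup.Commensurable.commensurator ((M.dpsc hne hprime).vertSub w) ⊓ M.PiG ≤ (M.dpsc hne hprime).vertSub w := by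
    intro w
    have h : Subgroup.Commensurable.commensurator ((M.dpsc hne hprime).vertSub w) ⊓ M.PiG.subtype.range ≤
        (M.dpsc hne hprime).vertSub w :=
      (isCommensurablyTerminal_subgroupOf_iff ((M.dpsc hne hprime).vertSub_le w)).mp
        (M.isCommensurablyTerminal_vertSub hne hprime w)
    rwa [Subgroup.range_subtype] at h
  have hKG : ∀ w : (M.dpsc hne hprime).Vert, (M.dpsc hne hprime).vertSub w ≤ M.PiG := fun w => by
    have h := (M.dpsc hne hprime).vertSub_le w
    rwa [dpsc_PiG] at h
  rcases M.vert_cases hne hprime v with rfl | rfl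
  · have hTsup : M.T ⊔ M.PiG = ⊤ := by rw [sup_comm]; exact M.PiG_sup_T
    rw [Dv_zero_eq, ← M.vertSub_zero hne hprime]
    exact M.isCommensurablyTerminal_sup_of_section _ _ (hK _) M.T_le_centralizer_vertGpA hTsup
      (M.sup_inf_PiG_eq_of_section _ _ (hKG _) M.T_le_centralizer_vertGpA M.T_inf_PiG)
  · rw [Dv_one_eq, ← M.vertSub_one hne hprime]
    exact M.isCommensurablyTerminal_sup_of_section _ _ (hK _) M.U_le_centralizer_vertGpB M.U_sup_PiG
      (M.sup_inf_PiG_eq_of_section _ _ (hKG _) M.U_le_centralizer_vertGpB (M.U_inf_PiG hne hprime))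

/-! ### Prop 1.3 (v), typed -/

/-- **[AbsTopII] Prop 1.3 (v) — the typed `DPSCData.Prop13v` (F-0278) — HOLDS at the two-vertex nodal DPSC datum,
every `Σ`, NO hypothesis**: at both vertices `D_v = C_{Π_H}(I_v) = N_{Π_H}(I_v)` is commensurably terminal in `Π_H`,
`D_v ∩ Π_𝔾 = Π_v`, and `Π_v` is commensurably terminal in `Π_𝔾`. [cite: MochizukiAbsTopII2013, Prop 1.3 (v) p.12] -/
theorem prop13v_dpsc (hne : Sigma.Nonempty) (hprime : ∀ p ∈ Sigma, p.Prime) :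
    Literature.AnabelianGeometry.AbsoluteAnabelian.DPSCData.Prop13v (M.dpsc hne hprime).toDPSCData := by
  intro v
  obtain ⟨h1, h2, -⟩ := M.Dv_eq_commensurator_Iv hne hprime v
  exact ⟨h1, h2, M.isCommensurablyTerminal_Dv hne hprime v, M.Dv_inf_PiG hne hprime v,
    M.isCommensurablyTerminal_vertSub hne hprime v⟩

/-- **[AbsTopII] Prop 1.3 (v), middle clause — the typed `DPSCIndexData.Prop_1_3_v'` (F-0300) — HOLDS at the two-vertex
nodal DPSC datum, every `Σ`, NO hypothesis**: `D_v ∩ Π_I = C_{Π_I}(I_v) = N_{Π_I}(I_v) = Z_{Π_I}(I_v)` commensurably terminal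
in `Π_I` (`Π_I = Π_H`; read inside `⊤` along the bijective `(⊤ : Subgroup P).subtype`, abc-iut-f-069's transport lemmas).
[cite: MochizukiAbsTopII2013, Prop 1.3 (v) p.12] -/
theorem prop_1_3_v'_dpsc (hne : Sigma.Nonempty) (hprime : ∀ p ∈ Sigma, p.Prime) :
    Literature.AnabelianGeometry.AbsoluteAnabelian.AbsTopII.DPSCIndexData.Prop_1_3_v' (M.dpsc hne hprime) := by
  intro v
  obtain ⟨h1, h2, h3⟩ := M.Dv_eq_commensurator_Iv hne hprime v
  rw [dpsc_PiI, inf_top_eq]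
  refine ⟨?_, ?_, ?_, ?_⟩
  · ext x
    change (x : (M.dpsc hne hprime).PiH) ∈ (M.dpsc hne hprime).Dv v ↔
      x ∈ Subgroup.Commensurable.commensurator
        (((M.dpsc hne hprime).Iv v).comap (⊤ : Subgroup (M.dpsc hne hprime).PiH).subtype)
    rw [DehnTwist.mem_commensurator_comap_iff_of_bijective DehnTwist.bijective_subtype_top, ← h1]
    rfl
  · ext x
    change (x : (M.dpsc hne hprime).PiH) ∈ (M.dpsc hne hprime).Dv v ↔ x ∈ Subgroup.normalizer
      ((((M.dpsc hne hprime).Iv v).comap (⊤ : Subgroup (M.dpsc hne hprime).PiH).subtype :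
        Subgroup ↥(⊤ : Subgroup (M.dpsc hne hprime).PiH)) : Set ↥(⊤ : Subgroup (M.dpsc hne hprime).PiH))
    rw [DehnTwist.mem_normalizer_comap_iff_of_bijective DehnTwist.bijective_subtype_top, ← h2]
    rfl
  · ext x
    change (x : (M.dpsc hne hprime).PiH) ∈ (M.dpsc hne hprime).Dv v ↔ x ∈ Subgroup.centralizer
      ((((M.dpsc hne hprime).Iv v).comap (⊤ : Subgroup (M.dpsc hne hprime).PiH).subtype :
        Subgroup ↥(⊤ : Subgroup (M.dpsc hne hprime).PiH)) : Set ↥(⊤ : Subgroup (M.dpsc hne hprime).PiH))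
    rw [DehnTwist.mem_centralizer_comap_iff_of_bijective DehnTwist.bijective_subtype_top, ← h3]
    rfl
  · exact DehnTwist.isCommensurablyTerminal_comap_of_bijective DehnTwist.bijective_subtype_top
      (M.isCommensurablyTerminal_Dv hne hprime v)

/-- **ONE DPSC datum WITH TWO VERTICES carrying the typed [AbsTopII] Prop 1.3 (i) ∧ (ii)′ ∧ (iii) ∧ (iii)′ ∧ (iv)′ ∧
(iv)-«Moreover» ∧ (v) ∧ (v)′ ∧ (vi) ∧ (vii) ∧ (ix) SIMULTANEOUSLY, for every nonempty set of primes `Σ`, NO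
hypothesis** (the degenerating 4-pointed sphere with the Dehn twist along its node).
[cite: MochizukiAbsTopII2013, Prop 1.3 p.11] -/
theorem exists_twoVertex_nodal_model_v (Sigma : Set ℕ) (hne : Sigma.Nonempty) (hprime : ∀ p ∈ Sigma, p.Prime) :
    ∃ X : DPSCIndexData.{0}, X.Sigma = Sigma ∧ (∃ v v' : X.Vert, v ≠ v' ∧ X.Adjacent v v') ∧ Nonempty X.Node ∧
      Literature.AnabelianGeometry.AbsoluteAnabelian.AbsTopII.DPSCIndexData.Prop_1_3_i X ∧
      Literature.AnabelianGeometry.AbsoluteAnabelian.AbsTopII.DPSCIndexData.Prop_1_3_ii' X ∧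
      Literature.AnabelianGeometry.AbsoluteAnabelian.DPSCData.Prop13iii X.toDPSCData ∧
      Literature.AnabelianGeometry.AbsoluteAnabelian.AbsTopII.DPSCIndexData.Prop_1_3_iii' X ∧
      Literature.AnabelianGeometry.AbsoluteAnabelian.DPSCData.Prop13iv' X.toDPSCData ∧
      Literature.AnabelianGeometry.AbsoluteAnabelian.DPSCData.Prop13iv_moreover X.toDPSCData ∧
      Literature.AnabelianGeometry.AbsoluteAnabelian.DPSCData.Prop13v X.toDPSCData ∧
      Literature.AnabelianGeometry.AbsoluteAnabelian.AbsTopII.DPSCIndexData.Prop_1_3_v' X ∧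
      Literature.AnabelianGeometry.AbsoluteAnabelian.DPSCData.Prop13vi X.toDPSCData ∧
      Literature.AnabelianGeometry.AbsoluteAnabelian.DPSCData.Prop13vii X.toDPSCData ∧
      Literature.AnabelianGeometry.AbsoluteAnabelian.DPSCData.Prop13ix X.toDPSCData := by
  obtain ⟨M⟩ := Model.nonempty Sigma
  exact ⟨M.dpsc hne hprime, rfl, ⟨⟨(0 : Fin 2)⟩, ⟨(1 : Fin 2)⟩, M.vert_zero_ne_one hne hprime, M.adjacent_dpsc hne hprime _ _⟩,
    ⟨⟨()⟩⟩, M.prop_1_3_i_dpsc hne hprime, M.prop_1_3_ii'_dpsc hne hprime, M.prop13iii_dpsc hne hprime,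
    M.prop_1_3_iii'_dpsc hne hprime, M.prop13iv'_dpsc hne hprime, M.prop13iv_moreover_dpsc hne hprime,
    M.prop13v_dpsc hne hprime, M.prop_1_3_v'_dpsc hne hprime, M.prop13vi_dpsc hne hprime, M.prop13vii_dpsc hne hprime,
    M.prop13ix_dpsc hne hprime⟩

end Literature.AnabelianGeometry.AbsoluteAnabelian.AbsTopII.TwoTripodNodal.Model

end
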